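import Summits.NavierStokesRegularity.FluidComputer.EulerRateClock
import Summits.NavierStokesRegularity.FluidComputer.SobolevLadderSerrin
import Summits.NavierStokesRegularity.FluidComputer.Besov32Forms
import HarnessLib

/-!
# Fluid computer — L59 in its other forms: with the datum's energy, time-integrated (`u ∉ L^{5/(2s)}_t Ḣ^s_x`),
# the viscosity-free front clock and the INVISCID COUNTDOWN PER LEVEL `∝ 2^{−5J/2}/‖u(0)‖₂`

HONEST FRAMING (cell `pub-fluidc`, verbatim): *low prior, high value-of-information experiment on Tao's
machine paradigm; NOT a claim that NS blows up.* Theorem side of the cell (the level dictionary); nothing here is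
evidence of blow-up. Companion of `EulerRateClock` (L59: for `κ > 5`, `c_κ (T − t)^{−2κ/5} ≤ ‖u(t)‖₂^{(2κ−10)/5} Y_κ(t)`,
`Y_κ = ∑_j 2^{κj} ‖Δ̇_j u‖₂²`, NO viscosity in `c_κ`), along every maximal smooth Leray–Hopf solution of the unforced
Navier–Stokes system on `ℝ³` (`ν > 0`):

* `row_clock_high_datum` — `c_κ (T − t)^{−2κ/5} ≤ ‖u(0)‖₂^{(2κ−10)/5} Y_κ(t)` (Leray's energy inequality);
* `homSobolev_high_log_floor`, `homSobolev_high_lintegral_eq_top` (**L59-S**) — for `s > 5/2`: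
  `c log((T − t₀)/(T − t)) ≤ ∫_{t₀}^t (‖u(0)‖₂^{(2s−5)/5} ‖u(τ)‖_{Ḣ^s})^{5/(2s)} dτ` and the integral over every terminal
  window is `∞`: `u ∉ L^{5/(2s)}(t₀, T; Ḣ^s)` (weaker than the scaling exponent `4/(2s−1) < 5/(2s)`, honest);
* `row_high_head_le`, `row_high_front_clock`, `row_high_countdown`, `row_high_tail_tendsto_top` (**L59″**) — the levels
  below `J` hold at most `2^{κ(J−1)}·8‖u(0)‖₂²` of `Y_κ`, so while the row above `J` is within that allowance,
  `c_κ (T − t)^{−2κ/5} ≤ 16 ‖u(0)‖₂^{2κ/5} 2^{κ(J−1)}`, i.e. **`T − t ≥ c'_κ · 2^{−5(J−1)/2} / ‖u(0)‖₂`** — an INVISCID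
  countdown per level (`2^{−5J/2}/‖u₀‖₂` has the dimension of time; no `ν`): compare the viscous countdowns
  `ν/(K 8^J ‖u₀‖₂²)` (L56″) and `ν³/…` (L22″) — above the level where `2^{J/2} ν ≈ ‖u₀‖₂` the inviscid one is the longer,
  hence the binding, necessity; every tail `∑_{j≥J}` of `Y_κ` tends to `∞`.

0 sorry; no definitions; no named facts.

## References

* J. C. Robinson, W. Sadowski, R. P. Silva, J. Math. Phys. 53 (2012) 115618, §VI (6.1). [RobinsonSadowskiSilva2012]
* J. Leray, Acta Math. 63 (1934), §19 p. 224 (energy inequality). [Leray1934]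
-/

noncomputable section

open MeasureTheory Set Function Filter Topology
open scoped ENNReal NNReal
open Literature.Analysis.FluidPDE Literature.Analysis.FunctionSpaces
open Summit.NavierStokesRegularity.FluidComputer.EulerRateClock
open Summit.NavierStokesRegularity.FluidComputer.SobolevLadderSerrin
open Summit.NavierStokesRegularity.FluidComputer.Besov32Forms (tsum_eq_low_add_tail)

namespace Summit.NavierStokesRegularity.FluidComputer.EulerRateForms

/-! ## L59 with the datum's energy -/

/-- **L59 WITH THE DATUM'S ENERGY (row form).** For every `κ > 5`, with the constant `c_κ` of `row_clock_high`: along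
every maximal smooth Leray–Hopf solution of the unforced system (`ν > 0`), at EVERY `t ∈ (0, T)`:
`c_κ (T − t)^{−2κ/5} ≤ ‖u(0)‖₂^{(2κ−10)/5} · ∑_j 2^{κj} ‖Δ̇_j u(t)‖₂²`. [cite: RobinsonSadowskiSilva2012, §VI (6.1)]
[cite: Leray1934, §19 p. 224] -/
theorem row_clock_high_datum {κ : ℝ} (hκ : 5 < κ) {ν T : ℝ} (hν : 0 < ν) (hT : 0 < T)
    {u : ℝ → EuclideanSpace ℝ (Fin 3) → EuclideanSpace ℝ (Fin 3)} {p : ℝ → EuclideanSpace ℝ (Fin 3) → ℝ}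
    (hmax : IsMaximalSmoothSolution ν 0 u p T) (hLH : IsLerayHopfOn T ν 0 (u 0) u) {t : ℝ} (ht : t ∈ Ioo 0 T) :
    ENNReal.ofReal ((row_clock_high hκ).choose * (T - t) ^ (-(2 * κ / 5))) ≤
      eLpNorm (u 0) 2 volume ^ ((2 * κ - 10) / 5) * ∑' j : ℤ, (2 : ℝ≥0∞) ^ (κ * (j : ℝ)) * blockL2 (u t) j ^ 2 := by
  have h := (row_clock_high hκ).choose_spec.2 ν T hν hT u p hmax hLH t ht
  refine h.trans (mul_le_mul' (ENNReal.rpow_le_rpow ?_ (by linarith)) le_rfl)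
  exact hLH.eLpNorm_le_eLpNorm_datum hν.le (hLH.memLp 0 ⟨le_rfl, hT.le⟩) ⟨ht.1.le, ht.2.le⟩

/-! ## L59-S: time-integrated -/

/-- **L59-S — LOGARITHMIC FLOOR OF THE RUNNING `L^{5/(2s)}_t Ḣ^s_x` INTEGRAL, `s > 5/2`.** For every `s > 5/2` there is
`c > 0` such that along every maximal smooth Leray–Hopf solution of the unforced system (`ν > 0`), for all
`0 ≤ t₀ ≤ t < T`: `c · log((T − t₀)/(T − t)) ≤ ∫⁻_{(t₀,t)} (‖u(0)‖₂^{(2s−5)/5} ‖u(τ)‖_{Ḣ^s})^{5/(2s)} dτ` (the datum form of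
`homSobolev_clock_high` raised to the exponent `5/(2s)` making its right side `∝ (T − τ)^{−1}`; no `ν`).
[cite: RobinsonSadowskiSilva2012, §VI (6.1)] -/
theorem homSobolev_high_log_floor (s : ℝ) (hs : 5 / 2 < s) :
    ∃ c : ℝ, 0 < c ∧ ∀ (ν T : ℝ), 0 < ν → 0 < T →
      ∀ (u : ℝ → EuclideanSpace ℝ (Fin 3) → EuclideanSpace ℝ (Fin 3)) (p : ℝ → EuclideanSpace ℝ (Fin 3) → ℝ),
      IsMaximalSmoothSolution ν 0 u p T → IsLerayHopfOn T ν 0 (u 0) u →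
      ∀ t₀ t : ℝ, 0 ≤ t₀ → t₀ ≤ t → t < T →
        ENNReal.ofReal (c * Real.log ((T - t₀) / (T - t))) ≤
          ∫⁻ τ in Ioo t₀ t, (eLpNorm (u 0) 2 volume ^ ((2 * s - 5) / 5) *
            Function.eHomSobolevSeminorm s (⇑EuclideanSpace.complexify ∘ u τ)) ^ (5 / (2 * s)) := by
  obtain ⟨c, hc, H⟩ := homSobolev_clock_high s hs
  have hs0 : 0 < s := by linarith
  have hb : 0 < 2 * s / 5 := by positivity
  refine ⟨c ^ (5 / (2 * s)), by positivity, fun ν T hν hT u p hmax hLH t₀ t ht₀ h₀ ht => ?_⟩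
  have e1 : 1 / (2 * s / 5) = 5 / (2 * s) := by rw [one_div_div]
  have h := log_le_lintegral_rpow_of_clock (c := c) (ν := ν) (a := (0 : ℝ)) (b := 2 * s / 5) (T := T) hc hν hb h₀ ht
    (X := fun τ => eLpNorm (u 0) 2 volume ^ ((2 * s - 5) / 5) *
      Function.eHomSobolevSeminorm s (⇑EuclideanSpace.complexify ∘ u τ))
    (fun τ hτ => by
      have hτI : τ ∈ Ioo 0 T := ⟨ht₀.trans_lt hτ.1, hτ.2.trans ht⟩
      have h1 := H ν T hν hT u p hmax hLH τ hτI
      have h2 : eLpNorm (u τ) 2 volume ^ ((2 * s - 5) / 5) ≤ eLpNorm (u 0) 2 volume ^ ((2 * s - 5) / 5) :=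
        ENNReal.rpow_le_rpow (hLH.eLpNorm_le_eLpNorm_datum hν.le (hLH.memLp 0 ⟨le_rfl, hT.le⟩)
          ⟨hτI.1.le, hτI.2.le⟩) (by linarith)
      simpa only [Real.rpow_zero, mul_one] using h1.trans (mul_le_mul' h2 le_rfl))
  rw [e1, Real.rpow_zero, mul_one] at h
  exact h

/-- **L59-S — `u ∉ L^{5/(2s)}(t₀, T; Ḣ^s)` ON EVERY TERMINAL WINDOW, `s > 5/2`**: along every maximal smooth Leray–Hopf
solution of the unforced system (`ν > 0`), for every `t₀ ∈ [0, T)`: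
`∫⁻_{(t₀,T)} ‖u(τ)‖_{Ḣ^s}^{5/(2s)} dτ = ∞`. HONEST: `5/(2s) > 4/(2s−1)` for `s > 5/2`, so this is weaker than the
(unproved above `5/2`) Sobolev–Serrin endpoint; it is what the rate `2s/5` gives. [cite: RobinsonSadowskiSilva2012, §VI (6.1)] -/
theorem homSobolev_high_lintegral_eq_top (s : ℝ) (hs : 5 / 2 < s) {ν T : ℝ} (hν : 0 < ν) (hT : 0 < T)
    {u : ℝ → EuclideanSpace ℝ (Fin 3) → EuclideanSpace ℝ (Fin 3)} {p : ℝ → EuclideanSpace ℝ (Fin 3) → ℝ}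
    (hmax : IsMaximalSmoothSolution ν 0 u p T) (hLH : IsLerayHopfOn T ν 0 (u 0) u)
    {t₀ : ℝ} (ht₀ : t₀ ∈ Ico 0 T) :
    ∫⁻ τ in Ioo t₀ T, Function.eHomSobolevSeminorm s (⇑EuclideanSpace.complexify ∘ u τ) ^ (5 / (2 * s)) = ∞ := by
  obtain ⟨c, hc, H⟩ := homSobolev_clock_high s hs
  have hs0 : 0 < s := by linarith
  have hb : 0 < 2 * s / 5 := by positivity
  have e1 : 1 / (2 * s / 5) = 5 / (2 * s) := by rw [one_div_div]
  set Ea : ℝ≥0∞ := eLpNorm (u 0) 2 volume ^ ((2 * s - 5) / 5) with hEa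
  have hu0 : MemLp (u 0) 2 volume := hLH.memLp 0 ⟨le_rfl, hT.le⟩
  have hEatop : Ea ≠ ∞ := ENNReal.rpow_ne_top_of_nonneg (by linarith) hu0.eLpNorm_ne_top
  have h := lintegral_rpow_eq_top_of_clock (c := c) (ν := ν) (a := (0 : ℝ)) (b := 2 * s / 5) hc hν hb ht₀.2
    (X := fun τ => Ea * Function.eHomSobolevSeminorm s (⇑EuclideanSpace.complexify ∘ u τ))
    (fun τ hτ => by
      have hτI : τ ∈ Ioo 0 T := ⟨ht₀.1.trans_lt hτ.1, hτ.2⟩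
      have h1 := H ν T hν hT u p hmax hLH τ hτI
      have h2 : eLpNorm (u τ) 2 volume ^ ((2 * s - 5) / 5) ≤ Ea :=
        ENNReal.rpow_le_rpow (hLH.eLpNorm_le_eLpNorm_datum hν.le hu0 ⟨hτI.1.le, hτI.2.le⟩) (by linarith)
      simpa only [Real.rpow_zero, mul_one] using h1.trans (mul_le_mul' h2 le_rfl))
  rw [e1] at h
  -- pull the constant `Ea^{5/(2s)}` out of the integral
  have hsplit : ∀ τ, (Ea * Function.eHomSobolevSeminorm s (⇑EuclideanSpace.complexify ∘ u τ)) ^ (5 / (2 * s)) =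
      Ea ^ (5 / (2 * s)) * Function.eHomSobolevSeminorm s (⇑EuclideanSpace.complexify ∘ u τ) ^ (5 / (2 * s)) :=
    fun τ => ENNReal.mul_rpow_of_nonneg _ _ (by positivity)
  simp_rw [hsplit] at h
  rw [lintegral_const_mul' _ _ (ENNReal.rpow_ne_top_of_nonneg (by positivity) hEatop)] at h
  exact (ENNReal.mul_eq_top.1 h).elim (fun h' => h'.2) (fun h' =>
    absurd h'.1 (ENNReal.rpow_ne_top_of_nonneg (by positivity) hEatop))

/-! ## L59″: the viscosity-free front clock and the inviscid countdown per level -/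

/-- **The levels below `J` hold at most `2^{κ(J−1)}·8‖u(0)‖₂²` of the row** (`κ > 0`): along a maximal smooth
Leray–Hopf solution of the unforced system, for every `t ∈ [0, T)` and every level `J`,
`∑_{j<J} 2^{κj} ‖Δ̇_j u(t)‖₂² ≤ 2^{κ(J−1)} · 8‖u(0)‖₂²` (`Besov32Forms.besov32_head_le` is `κ = 3`).
[cite: BahouriCheminDanchin2011, Prop. 2.12] -/
theorem row_high_head_le {κ : ℝ} (hκ : 0 < κ) {ν T : ℝ} (hν : 0 < ν) (hT : 0 < T)
    {u : ℝ → EuclideanSpace ℝ (Fin 3) → EuclideanSpace ℝ (Fin 3)}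
    (hLH : IsLerayHopfOn T ν 0 (u 0) u) {t : ℝ} (ht : t ∈ Ico 0 T) (J : ℤ) :
    ∑' j : {j : ℤ // j < J}, (2 : ℝ≥0∞) ^ (κ * ((j : ℤ) : ℝ)) * blockL2 (u t) j ^ 2 ≤
      (2 : ℝ≥0∞) ^ (κ * ((J - 1 : ℤ) : ℝ)) * (8 * eLpNorm (u 0) 2 volume ^ 2) := by
  set K := lpBounds (Fin 3) with hK
  have hut : MemLp (u t) 2 volume := hLH.memLp t ⟨ht.1, ht.2.le⟩
  have hu0 : MemLp (u 0) 2 volume := hLH.memLp 0 ⟨le_rfl, hT.le⟩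
  have hw : ∀ j : {j : ℤ // j < J}, (2 : ℝ≥0∞) ^ (κ * ((j : ℤ) : ℝ)) ≤ (2 : ℝ≥0∞) ^ (κ * ((J - 1 : ℤ) : ℝ)) :=
    fun j => by
    refine ENNReal.rpow_le_rpow_of_exponent_le one_le_two ?_
    have hj : ((j : ℤ) : ℝ) ≤ ((J - 1 : ℤ) : ℝ) := by exact_mod_cast Int.le_sub_one_of_lt j.2
    exact mul_le_mul_of_nonneg_left hj hκ.le
  calc ∑' j : {j : ℤ // j < J}, (2 : ℝ≥0∞) ^ (κ * ((j : ℤ) : ℝ)) * blockL2 (u t) j ^ 2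
      ≤ ∑' j : {j : ℤ // j < J}, (2 : ℝ≥0∞) ^ (κ * ((J - 1 : ℤ) : ℝ)) * blockL2 (u t) j ^ 2 :=
        ENNReal.tsum_le_tsum fun j => mul_le_mul' (hw j) le_rfl
    _ = (2 : ℝ≥0∞) ^ (κ * ((J - 1 : ℤ) : ℝ)) * ∑' j : {j : ℤ // j < J}, blockL2 (u t) j ^ 2 := ENNReal.tsum_mul_left
    _ ≤ (2 : ℝ≥0∞) ^ (κ * ((J - 1 : ℤ) : ℝ)) * ∑' j : ℤ, blockL2 (u t) j ^ 2 := by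
        gcongr
        exact ENNReal.tsum_comp_le_tsum_of_injective Subtype.val_injective (fun j : ℤ => blockL2 (u t) j ^ 2)
    _ ≤ (2 : ℝ≥0∞) ^ (κ * ((J - 1 : ℤ) : ℝ)) * (8 * eLpNorm (u t) 2 volume ^ 2) := by
        gcongr
        exact K.sq_le (u t) hut
    _ ≤ (2 : ℝ≥0∞) ^ (κ * ((J - 1 : ℤ) : ℝ)) * (8 * eLpNorm (u 0) 2 volume ^ 2) := by
        gcongr _ * (8 * ?_)
        exact pow_le_pow_left' (hLH.eLpNorm_le_eLpNorm_datum hν.le hu0 ⟨ht.1, ht.2.le⟩) 2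

/-- **L59″ — THE VISCOSITY-FREE FRONT CLOCK.** For every `κ > 5`, with the constant `c_κ` of `row_clock_high`: along
every maximal smooth Leray–Hopf solution of the unforced system (`ν > 0`), at EVERY `t ∈ (0, T)` and for EVERY level `J`,
`c_κ (T − t)^{−2κ/5} ≤ ‖u(0)‖₂^{(2κ−10)/5} · (2^{κ(J−1)}·8‖u(0)‖₂² + ∑_{n≥0} 2^{κ(J+n)} ‖Δ̇_{J+n} u(t)‖₂²)`.
[cite: RobinsonSadowskiSilva2012, §VI (6.1)] [cite: BahouriCheminDanchin2011, Prop. 2.12] -/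
theorem row_high_front_clock {κ : ℝ} (hκ : 5 < κ) {ν T : ℝ} (hν : 0 < ν) (hT : 0 < T)
    {u : ℝ → EuclideanSpace ℝ (Fin 3) → EuclideanSpace ℝ (Fin 3)} {p : ℝ → EuclideanSpace ℝ (Fin 3) → ℝ}
    (hmax : IsMaximalSmoothSolution ν 0 u p T) (hLH : IsLerayHopfOn T ν 0 (u 0) u) {t : ℝ} (ht : t ∈ Ioo 0 T)
    (J : ℤ) :
    ENNReal.ofReal ((row_clock_high hκ).choose * (T - t) ^ (-(2 * κ / 5))) ≤
      eLpNorm (u 0) 2 volume ^ ((2 * κ - 10) / 5) *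
        ((2 : ℝ≥0∞) ^ (κ * ((J - 1 : ℤ) : ℝ)) * (8 * eLpNorm (u 0) 2 volume ^ 2) +
          ∑' n : ℕ, (2 : ℝ≥0∞) ^ (κ * ((J + n : ℤ) : ℝ)) * blockL2 (u t) (J + n) ^ 2) := by
  refine (row_clock_high_datum hκ hν hT hmax hLH ht).trans (mul_le_mul' le_rfl ?_)
  rw [tsum_eq_low_add_tail (fun j : ℤ => (2 : ℝ≥0∞) ^ (κ * (j : ℝ)) * blockL2 (u t) j ^ 2) J]
  exact add_le_add (row_high_head_le (by linarith) hν hT hLH ⟨ht.1.le, ht.2⟩ J) le_rfl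

/-- **L59″ — THE INVISCID COUNTDOWN PER LEVEL.** For every `κ > 5`, with the constant `c_κ` of `row_clock_high`: along
every maximal smooth Leray–Hopf solution of the unforced system (`ν > 0`), at every `t ∈ (0, T)` and for every level `J`,
IF the `κ`-row above `J` is within the head allowance, `∑_{n≥0} 2^{κ(J+n)} ‖Δ̇_{J+n} u(t)‖₂² ≤ 2^{κ(J−1)}·8‖u(0)‖₂²`, THEN
`c_κ (T − t)^{−2κ/5} ≤ 2 · ‖u(0)‖₂^{(2κ−10)/5} · 2^{κ(J−1)} · 8‖u(0)‖₂²` (real numbers), i.e.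
`T − t ≥ (c_κ/16)^{5/(2κ)} · 2^{−5(J−1)/2} / ‖u(0)‖₂`: EVERY UNPASSED LEVEL CERTIFIES A REMAINING TIME `∝ 2^{−5J/2}/‖u(0)‖₂`
WITH NO VISCOSITY (the Euler time scale of level `J` at energy `‖u₀‖₂²`); the viscous countdowns `ν/(K 8^J‖u₀‖₂²)` (L56″)
are shorter above the level where `2^{J/2}ν ≈ ‖u₀‖₂`. [cite: RobinsonSadowskiSilva2012, §VI (6.1)] -/
theorem row_high_countdown {κ : ℝ} (hκ : 5 < κ) {ν T : ℝ} (hν : 0 < ν) (hT : 0 < T)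
    {u : ℝ → EuclideanSpace ℝ (Fin 3) → EuclideanSpace ℝ (Fin 3)} {p : ℝ → EuclideanSpace ℝ (Fin 3) → ℝ}
    (hmax : IsMaximalSmoothSolution ν 0 u p T) (hLH : IsLerayHopfOn T ν 0 (u 0) u) {t : ℝ} (ht : t ∈ Ioo 0 T)
    (J : ℤ)
    (hfront : (∑' n : ℕ, (2 : ℝ≥0∞) ^ (κ * ((J + n : ℤ) : ℝ)) * blockL2 (u t) (J + n) ^ 2) ≤
      (2 : ℝ≥0∞) ^ (κ * ((J - 1 : ℤ) : ℝ)) * (8 * eLpNorm (u 0) 2 volume ^ 2)) :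
    (row_clock_high hκ).choose * (T - t) ^ (-(2 * κ / 5)) ≤
      2 * ((eLpNorm (u 0) 2 volume).toReal ^ ((2 * κ - 10) / 5) *
        ((2 : ℝ) ^ (κ * ((J - 1 : ℤ) : ℝ)) * (8 * (eLpNorm (u 0) 2 volume).toReal ^ 2))) := by
  have hTt : 0 < T - t := sub_pos.2 ht.2
  have hc := (row_clock_high hκ).choose_spec.1
  have hu0 : MemLp (u 0) 2 volume := hLH.memLp 0 ⟨le_rfl, hT.le⟩
  set Ea : ℝ≥0∞ := eLpNorm (u 0) 2 volume ^ ((2 * κ - 10) / 5) with hEa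
  have hEatop : Ea ≠ ∞ := ENNReal.rpow_ne_top_of_nonneg (by linarith) hu0.eLpNorm_ne_top
  set Hd : ℝ≥0∞ := (2 : ℝ≥0∞) ^ (κ * ((J - 1 : ℤ) : ℝ)) * (8 * eLpNorm (u 0) 2 volume ^ 2) with hHd
  have hHdtop : Hd ≠ ∞ := ENNReal.mul_ne_top (RiccatiSlice.two_rpow_ne_top _)
    (ENNReal.mul_ne_top (by norm_num) (ENNReal.pow_ne_top hu0.eLpNorm_ne_top))
  have hEar : Ea.toReal = (eLpNorm (u 0) 2 volume).toReal ^ ((2 * κ - 10) / 5) := by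
    rw [hEa, ← ENNReal.toReal_rpow]
  have hHdr : Hd.toReal = (2 : ℝ) ^ (κ * ((J - 1 : ℤ) : ℝ)) * (8 * (eLpNorm (u 0) 2 volume).toReal ^ 2) := by
    rw [hHd, ENNReal.toReal_mul, ENNReal.toReal_mul, ENNReal.toReal_pow, ← ENNReal.toReal_rpow,
      ENNReal.toReal_ofNat, ENNReal.toReal_ofNat]
  have h1 := (row_high_front_clock hκ hν hT hmax hLH ht J).trans (mul_le_mul' le_rfl (add_le_add le_rfl hfront))
  rw [← two_mul] at h1
  have h2 := ENNReal.toReal_mono (ENNReal.mul_ne_top hEatop (ENNReal.mul_ne_top (by norm_num) hHdtop)) h1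
  rw [ENNReal.toReal_ofReal (by positivity), ENNReal.toReal_mul, ENNReal.toReal_mul, ENNReal.toReal_ofNat,
    hEar, hHdr] at h2
  linarith

/-- **L59″ — EVERY TAIL OF EVERY HIGH ROW DIVERGES** (`κ > 3`): along every maximal smooth Leray–Hopf solution of the
unforced system (`ν > 0`), for every fixed level `J`, `∑_{n≥0} 2^{κ(J+n)} ‖Δ̇_{J+n} u(t)‖₂² → ∞` as `t ↑ T` (the head below
`J` is bounded by `2^{κ(J−1)}·8‖u(0)‖₂²` uniformly in time; the row tends to `∞`, `HighRows.row_tendsto_top`).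
[cite: RobinsonSadowskiSilva2012, §VI (6.1)] -/
theorem row_high_tail_tendsto_top {κ : ℝ} (hκ : 3 < κ) {ν T : ℝ} (hν : 0 < ν) (hT : 0 < T)
    {u : ℝ → EuclideanSpace ℝ (Fin 3) → EuclideanSpace ℝ (Fin 3)} {p : ℝ → EuclideanSpace ℝ (Fin 3) → ℝ}
    (hmax : IsMaximalSmoothSolution ν 0 u p T) (hLH : IsLerayHopfOn T ν 0 (u 0) u) (J : ℤ) :
    Tendsto (fun t => ∑' n : ℕ, (2 : ℝ≥0∞) ^ (κ * ((J + n : ℤ) : ℝ)) * blockL2 (u t) (J + n) ^ 2)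
      (𝓝[<] T) (𝓝 ∞) := by
  have hu0 : MemLp (u 0) 2 volume := hLH.memLp 0 ⟨le_rfl, hT.le⟩
  set Hd : ℝ≥0∞ := (2 : ℝ≥0∞) ^ (κ * ((J - 1 : ℤ) : ℝ)) * (8 * eLpNorm (u 0) 2 volume ^ 2) with hHd
  have hHdtop : Hd ≠ ∞ := ENNReal.mul_ne_top (RiccatiSlice.two_rpow_ne_top _)
    (ENNReal.mul_ne_top (by norm_num) (ENNReal.pow_ne_top hu0.eLpNorm_ne_top))
  have hY := HighRows.row_tendsto_top hκ hν hT hmax hLH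
  have hle : ∀ᶠ t in 𝓝[<] T, ∑' j : ℤ, (2 : ℝ≥0∞) ^ (κ * (j : ℝ)) * blockL2 (u t) j ^ 2 ≤
      Hd + ∑' n : ℕ, (2 : ℝ≥0∞) ^ (κ * ((J + n : ℤ) : ℝ)) * blockL2 (u t) (J + n) ^ 2 := by
    filter_upwards [Ioo_mem_nhdsLT hT] with t ht
    rw [tsum_eq_low_add_tail (fun j : ℤ => (2 : ℝ≥0∞) ^ (κ * (j : ℝ)) * blockL2 (u t) j ^ 2) J]
    exact add_le_add (row_high_head_le (by linarith) hν hT hLH ⟨ht.1.le, ht.2⟩ J) le_rfl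
  rw [ENNReal.tendsto_nhds_top_iff_nnreal] at hY ⊢
  intro x
  have hx : ∀ᶠ t in 𝓝[<] T, ((x : ℝ≥0∞) + Hd) < ∑' j : ℤ, (2 : ℝ≥0∞) ^ (κ * (j : ℝ)) * blockL2 (u t) j ^ 2 := by
    have h := hY ((x : ℝ≥0∞) + Hd).toNNReal
    rwa [ENNReal.coe_toNNReal (ENNReal.add_ne_top.2 ⟨ENNReal.coe_ne_top, hHdtop⟩)] at h
  filter_upwards [hx, hle] with t h1 h2
  have h3 : (x : ℝ≥0∞) + Hd < Hd + ∑' n : ℕ, (2 : ℝ≥0∞) ^ (κ * ((J + n : ℤ) : ℝ)) *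
      blockL2 (u t) (J + n) ^ 2 := h1.trans_le h2
  rw [add_comm (x : ℝ≥0∞)] at h3
  exact (ENNReal.add_lt_add_iff_left hHdtop).1 h3

end Summit.NavierStokesRegularity.FluidComputer.EulerRateForms

end
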